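import Mathlib
import Summits.Ventures.HodgeRepro.CMType
import Summits.Ventures.HodgeRepro.HodgeSets
import Summits.Ventures.HodgeRepro.CMRank
import Summits.Ventures.HodgeRepro.MuTable
import Summits.Ventures.HodgeRepro.EngineFaces

/-!
# The μ-table of a product of CM abelian varieties (blind cell `pub-hodge-repro`, seat p2)

For a product `∏_{i} A_{T_i}` of CM abelian varieties with CM by the same Galois CM field (types
`T_i ⊆ G`), the basis classes of `H^*` are indexed by *exponent vectors* `(Δ_i)_i` (`Δ_i ⊆ G` the
embeddings used from the `i`-th factor), and such a class is Hodge iff its μ-table row is constant: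
`Σ_i |Δ_i ∩ g T_i| = p` for every `g ∈ G`, where `2p = Σ_i |Δ_i|` (Pohlmann's criterion read off the
exponent vectors, Ann. of Math. 88 (1968) Thm. 1; the Mumford–Tate torus of the product has
cocharacter `(μ_{T_i})_i` and its Galois conjugates).  For a face `(Φ; π, π′)` with corner product
`∏_{i<4} A_{corner_i}` the *Weil lines* are the exponent vectors `Δ_i = {s}` (the same embedding in
every factor); `SumTwo` says exactly that they are Hodge of type `(2,2)` (Deligne LNM 900 §5 (c),
`d = 4`; Milne 2020 §2.2).
-/

set_option autoImplicit false

open Finset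
open scoped Pointwise

namespace HodgeRepro

variable {G : Type*} [Group G] [DecidableEq G] {k : ℕ}

/-- The μ-table entry of an exponent vector on a product: `Σ_i |Δ_i ∩ g T_i|`. -/
def muValFam (T Δ : Fin k → Finset G) (g : G) : ℕ := ∑ i, muVal (T i) (Δ i) g

/-- Pohlmann's criterion for a product: the exponent vector `Δ` is a Hodge class on `∏ A_{T_i}`. -/
def IsHodgeFam (T Δ : Fin k → Finset G) : Prop :=
  ∀ g : G, 2 * muValFam T Δ g = ∑ i, (Δ i).card

/-- `IsHodgeFam T Δ` is decidable for a finite group. -/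
instance (T Δ : Fin k → Finset G) [Fintype G] : Decidable (IsHodgeFam T Δ) := by
  unfold IsHodgeFam; infer_instance

/-- A single factor: the product criterion is the usual one. -/
theorem isHodgeFam_single [Fintype G] {c : G} (hc : IsComplexConj c) {Φ : Finset G} (hΦ : IsCMType c Φ)
    (Δ : Finset G) : IsHodgeFam (fun _ : Fin 1 => Φ) (fun _ => Δ) ↔ IsHodgeSet c Φ Δ := by
  rw [isHodgeSet_iff_muVal hc hΦ]
  unfold IsHodgeFam muValFam
  simp only [Fin.sum_univ_one]

/-- The conjugation rule for products: `μ(g) + μ(c g) = Σ_i |Δ_i|`. -/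
theorem muValFam_add_muValFam_conj [Fintype G] {c : G} (hc : IsComplexConj c) {T : Fin k → Finset G}
    (hT : ∀ i, IsCMType c (T i)) (Δ : Fin k → Finset G) (g : G) :
    muValFam T Δ g + muValFam T Δ (c * g) = ∑ i, (Δ i).card := by
  unfold muValFam
  rw [← sum_add_distrib]
  exact sum_congr rfl fun i _ => muVal_add_muVal_conj hc (hT i) (Δ i) g

/-- The μ-table entry of the exponent vector `Δ_i = {s}` is the number of `i` with `s ∈ g T_i`. -/
theorem muValFam_singleton (T : Fin k → Finset G) (s g : G) :
    muValFam T (fun _ => {s}) g = (univ.filter fun i => s ∈ g • T i).card := by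
  unfold muValFam muVal
  rw [card_filter]
  refine sum_congr rfl fun i _ => ?_
  by_cases h : s ∈ g • T i
  · rw [if_pos h, singleton_inter_of_mem h, card_singleton]
  · rw [if_neg h, singleton_inter_of_notMem h, card_empty]

/-- **Weil lines of a face are Hodge.**  For the corner product of a face `(Φ; π, π′)` (disjoint places) and
any embedding `s`, the exponent vector `(s, s, s, s)` satisfies Pohlmann's criterion with `p = 2`. -/
theorem isHodgeFam_corners [Fintype G] {c : G} {Φ π π' : Finset G} (hc : IsComplexConj c)
    (hΦ : IsCMType c Φ) (hd : Disjoint π π') (s : G) :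
    IsHodgeFam (cornersM c Φ π π') (fun _ => {s}) := by
  intro g
  rw [muValFam_singleton]
  simp only [card_singleton, sum_const, card_univ, Fintype.card_fin, smul_eq_mul, mul_one]
  -- `s ∈ g • corner_i ↔ g⁻¹ s ∈ corner_i`, and `SumTwo` at `g⁻¹ s`
  have h := card_filter_mem_corners hc hΦ hd (g⁻¹ * s)
  have heq : (univ.filter fun i : Fin 4 => s ∈ g • cornersM c Φ π π' i) =
      univ.filter fun i : Fin 4 => g⁻¹ * s ∈ cornersM c Φ π π' i := by
    refine filter_congr fun i _ => ?_
    rw [← inv_smul_mem_iff, smul_eq_mul]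
  rw [heq, h]

/-- The μ-table of the Weil line `(s,s,s,s)` of a face is the constant row `2`. -/
theorem muValFam_corners_eq_two [Fintype G] {c : G} {Φ π π' : Finset G} (hc : IsComplexConj c)
    (hΦ : IsCMType c Φ) (hd : Disjoint π π') (s g : G) :
    muValFam (cornersM c Φ π π') (fun _ => {s}) g = 2 := by
  have h := isHodgeFam_corners hc hΦ hd s g
  simp only [card_singleton, sum_const, card_univ, Fintype.card_fin, smul_eq_mul, mul_one] at h
  omega

/-! ### Divisor-pair factors of a Weil line: the meaning of `noConjugateCorners` -/

/-- A two-factor sub-line `{(i,s), (j,s)}` of a product `∏ A_{T_l}` is a Hodge `(1,1)`-class iff the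
two types are complex conjugate: `T_j = c • T_i`. -/
theorem isHodgeFam_pair_singleton_iff [Fintype G] {c : G} (hc : IsComplexConj c) (T₁ T₂ : Finset G)
    (hT₁ : IsCMType c T₁) (s : G) :
    IsHodgeFam (![T₁, T₂] : Fin 2 → Finset G) (fun _ => {s}) ↔ T₂ = c • T₁ := by
  unfold IsHodgeFam muValFam
  simp only [Fin.sum_univ_two, Matrix.cons_val_zero, Matrix.cons_val_one, card_singleton]
  constructor
  · intro h
    ext x
    -- choose `g` with `g⁻¹ s = x`, i.e. `g = s x⁻¹`
    have hx := h (s * x⁻¹)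
    have h1 : s ∈ (s * x⁻¹) • T₁ ↔ x ∈ T₁ := by
      rw [← inv_smul_mem_iff, smul_eq_mul, _root_.mul_inv_rev, inv_inv, mul_assoc, inv_mul_cancel, mul_one]
    have h2 : s ∈ (s * x⁻¹) • T₂ ↔ x ∈ T₂ := by
      rw [← inv_smul_mem_iff, smul_eq_mul, _root_.mul_inv_rev, inv_inv, mul_assoc, inv_mul_cancel, mul_one]
    have h3 : x ∈ c • T₁ ↔ x ∉ T₁ := by rw [hT₁.smul_eq_compl hc, mem_compl]
    unfold muVal at hx
    rw [h3]
    by_cases hx1 : x ∈ T₁ <;> by_cases hx2 : x ∈ T₂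
    · rw [singleton_inter_of_mem (h1.2 hx1), singleton_inter_of_mem (h2.2 hx2)] at hx
      simp at hx
    · tauto
    · tauto
    · rw [singleton_inter_of_notMem (fun h => hx1 (h1.1 h)),
        singleton_inter_of_notMem (fun h => hx2 (h2.1 h))] at hx
      simp at hx
  · rintro rfl g
    unfold muVal
    have h3 : g • c • T₁ = (g • T₁)ᶜ := by
      rw [← hc.smul_comm_finset, (hT₁.smul hc g).smul_eq_compl hc]
    rw [h3]
    by_cases hs : s ∈ g • T₁
    · rw [singleton_inter_of_mem hs, singleton_inter_of_notMem (by rwa [mem_compl, not_not])]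
      simp
    · rw [singleton_inter_of_notMem hs, singleton_inter_of_mem (mem_compl.2 hs)]
      simp

/-- **`noConjugateCorners` means: the Weil line has no divisor-pair factor.**  For a face whose corners are
pairwise non-conjugate, no two-factor sub-line `{(i,s),(j,s)}` of the Weil line `(s,s,s,s)` is a Hodge
class (the `(2,2)`-class is not a product of two `(1,1)`-classes of this monomial form). -/
theorem not_isHodgeFam_pair_of_noConj [Fintype G] {c : G} (hc : IsComplexConj c)
    (T : Fin 4 → Finset G) (hT : ∀ i, IsCMType c (T i))
    (hnc : ∀ i j, T j ≠ c • T i) (i j : Fin 4) (s : G) :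
    ¬ IsHodgeFam (![T i, T j] : Fin 2 → Finset G) (fun _ => {s}) := by
  rw [isHodgeFam_pair_singleton_iff hc _ _ (hT i)]
  exact hnc i j

end HodgeRepro
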